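import Summits.Schanuel.Schanuel.Theorems.ZilberEacInvariantDirectionExistence
import Literature.ModelTheory.Zilber.EACDensityQuestion
import HarnessLib

/-!
# Real hyperplanes, slow regime: LABELLED existence with convergent transversal data

Zilber's Exponential-Algebraic Closedness, case ladder (host summit Schanuel, cell `pub-schanuel`,
seat 2, gen 12).  THEOREM R⁺ (`ZilberEacComplexRealHyperplaneSlow.exists_expPoint_realHyperplane_slow`)
solves `e^{xⱼ} = Aⱼ(x) + e^{ℓ(x)} Fⱼ(e^{ℓ(x)})`, `ℓ(x) = Σ rᵢ xᵢ + c` (`rᵢ ∈ ℝ`), within `1/2` of the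
principal lattice centres of every ray `2πi m q` with `(Aⱼ)_{dⱼ}(2πi q) ≠ 0`, in the slow regime
`λ + max(λ,0) deg Fⱼ < dⱼ`, `λ = Σ rᵢ dᵢ`.  THEOREM M (`ZilberEacRotatingPower`) needs more: for every
LABEL `p ∈ ℤˢ` a solution family

  `x(m) = ρ(m) + (log m) d + (2πi m) q`,   `ρ(m) → ρ_p = 2πi p + log a`   (`aⱼ = (Aⱼ)_{dⱼ}(2πi q)`),

i.e. CONVERGENT transversal data after removing the escape `2πi m q` and the drift `(log m) d`.
This is the moving-polydisc contraction around the labelled centres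
`c(m)ⱼ = 2πi(m qⱼ + pⱼ) + dⱼ log m + log aⱼ + log(Aⱼ(2πimq)/(m^{dⱼ}aⱼ))` (a continuous logarithm of
`Aⱼ(2πi m q)`, `ZilberEacMovingPolydiscCentres.exists_exp_eq_poly_add_near_centre`) with the
slow-regime bound `|e^{ℓ}| ≤ e^{C₀} m^{λ}` on the unit polydiscs, followed by diagonal extraction.

* `exists_solutions_hyperplane_slow` — the labelled existence theorem (every `s`, every label).

HONEST FRAMING: an existence theorem for explicit families inside an OPEN cell (the unlabelled form
is THEOREM R⁺, gen 7); `EC(3,2)` OPEN; NOT Schanuel's conjecture; EAC ⇏ SC.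
-/

noncomputable section

open Complex MvPolynomial Metric Set Filter Topology
open Literature.NumberTheory.Transcendental Literature.ModelTheory.Zilber

set_option linter.dupNamespace false

namespace Summit.Schanuel.Schanuel.Theorems

section SlowLabelled

variable {s : ℕ}

/-- **Labelled existence over real hyperplanes in the slow regime.**  `r ∈ ℝˢ`, `c ∈ ℂ`, a lattice
direction `q` with `(Aⱼ)_{dⱼ}(2πi q) ≠ 0`, fibre polynomials `Fⱼ ∈ ℂ[u]` with
`λ + max(λ,0) deg Fⱼ < dⱼ` (`λ = Σ rᵢ dᵢ`): for every label `p ∈ ℤˢ` there are solutions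
`x(m) = ρ(m) + (log m) d + (2πi m) q` of `e^{xⱼ} = Aⱼ(x) + e^{ℓ(x)}Fⱼ(e^{ℓ(x)})` (large `m`) with
`ρ(m) → 2πi p + log a`. (new)
[cite: MantovaMasser2023, §1 p.5 (the open case dim π(V) = 2 in ℂ³×ℂˣ³)] -/
theorem exists_solutions_hyperplane_slow (r : Fin s → ℝ) (c : ℂ) (q : Fin s → ℤ)
    (A : Fin s → MvPolynomial (Fin s) ℂ)
    (hA : ∀ j, eval (fun i => 2 * Real.pi * I * (q i : ℂ))
      (homogeneousComponent (A j).totalDegree (A j)) ≠ 0)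
    (F : Fin s → Polynomial ℂ)
    (hlam : ∀ j, (∑ i, r i * (A i).totalDegree) +
      max (∑ i, r i * (A i).totalDegree) 0 * ((F j).natDegree : ℝ) < (A j).totalDegree)
    (p : Fin s → ℤ) :
    ∃ (x ρ : ℕ → Fin s → ℂ),
      (∀ᶠ m : ℕ in atTop, ∀ j, exp (x m j) = eval (x m) (A j) +
        exp (∑ i, (r i : ℂ) * x m i + c) * (F j).eval (exp (∑ i, (r i : ℂ) * x m i + c))) ∧
      (∀ m, x m = ρ m + ((Real.log m : ℝ) : ℂ) • (fun j => (((A j).totalDegree : ℕ) : ℂ)) +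
        (2 * Real.pi * I * (m : ℂ)) • fun j => (q j : ℂ)) ∧
      Tendsto ρ atTop (𝓝 fun j => 2 * Real.pi * I * (p j : ℂ) +
        log (eval (fun i => 2 * Real.pi * I * (q i : ℂ))
          (homogeneousComponent (A j).totalDegree (A j)))) := by
  classical
  -- data: leading values `a`, the ratios `Aⱼ(m v)/(m^{dⱼ} aⱼ) → 1`
  obtain ⟨a, ha⟩ : ∃ a : Fin s → ℂ, a = fun j => eval (fun i => 2 * Real.pi * I * (q i : ℂ))
    (homogeneousComponent (A j).totalDegree (A j)) := ⟨_, rfl⟩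
  have ha0 : ∀ j, a j ≠ 0 := fun j => by rw [ha]; exact hA j
  obtain ⟨d, hd⟩ : ∃ d : Fin s → ℂ, d = fun j => (((A j).totalDegree : ℕ) : ℂ) := ⟨_, rfl⟩
  obtain ⟨ratio, hratio⟩ : ∃ ratio : Fin s → ℕ → ℂ, ratio = fun j (m : ℕ) =>
    eval (fun i => (m : ℂ) * (2 * Real.pi * I * (q i : ℂ))) (A j) /
      ((m : ℂ) ^ (A j).totalDegree * a j) := ⟨_, rfl⟩
  have hratio1 : ∀ j, Tendsto (ratio j) atTop (𝓝 1) := by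
    intro j
    rw [hratio, ha]
    exact tendsto_latticeValue_div (A j) _ (hA j)
  have hlogratio : ∀ j, Tendsto (fun m => log (ratio j m)) atTop (𝓝 0) := by
    intro j
    have h := (hratio1 j).clog Complex.one_mem_slitPlane
    rwa [Complex.log_one] at h
  have hratio_ne : ∀ᶠ m : ℕ in atTop, ∀ j, ratio j m ≠ 0 :=
    eventually_all.2 fun j => (hratio1 j).eventually (isOpen_ne.mem_nhds one_ne_zero)
  -- the logarithm branch, `y(m) = 2πi m`, the transversal part `rc(m)` (with drift), the centres
  obtain ⟨lb, hlb⟩ : ∃ lb : ℕ → Fin s → ℂ, lb = fun (m : ℕ) j =>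
    (((A j).totalDegree : ℕ) : ℂ) * log (m : ℂ) + log (a j) + log (ratio j m) := ⟨_, rfl⟩
  obtain ⟨y, hy⟩ : ∃ y : ℕ → ℂ, y = fun (m : ℕ) => 2 * Real.pi * I * (m : ℂ) := ⟨_, rfl⟩
  obtain ⟨rp, hrp⟩ : ∃ rp : ℕ → Fin s → ℂ,
    rp = fun (m : ℕ) j => 2 * Real.pi * I * (p j : ℂ) + log (a j) + log (ratio j m) := ⟨_, rfl⟩
  obtain ⟨rc, hrc⟩ : ∃ rc : ℕ → Fin s → ℂ,
    rc = fun (m : ℕ) => rp m + (log (m : ℂ)) • d := ⟨_, rfl⟩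
  obtain ⟨cen, hcen⟩ : ∃ cen : ℕ → Fin s → ℂ, cen = fun m => rc m + y m • fun j => (q j : ℂ) :=
    ⟨_, rfl⟩
  have hc' : ∀ m j, cen m j = (m : ℂ) * (2 * Real.pi * I * (q j : ℂ)) +
      (2 * Real.pi * I * (p j : ℂ) + lb m j) := by
    intro m j
    simp only [hcen, hrc, hrp, hy, hlb, hd, Pi.add_apply, Pi.smul_apply, smul_eq_mul]
    ring
  -- the convergent part of the centres
  have hrp_lim : Tendsto rp atTop (𝓝 fun j => 2 * Real.pi * I * (p j : ℂ) + log (a j)) := by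
    rw [hrp]
    refine tendsto_pi_nhds.2 fun j => ?_
    have h := (hlogratio j).const_add (2 * Real.pi * I * (p j : ℂ) + log (a j))
    rwa [add_zero] at h
  -- (C1) `exp cen(m)ⱼ = Aⱼ(m v)` eventually
  have hcexp : ∀ᶠ m : ℕ in atTop, ∀ j,
      exp (cen m j) = eval (fun k => (m : ℂ) * (2 * Real.pi * I * (q k : ℂ))) (A j) := by
    filter_upwards [hratio_ne, eventually_ge_atTop 1] with m hm hm1 j
    have hmC : (m : ℂ) ≠ 0 := by exact_mod_cast (show m ≠ 0 by omega)
    rw [hc', Complex.exp_add, exp_natCast_mul_twoPiI_mul_intCast, one_mul, Complex.exp_add,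
      exp_two_pi_I_mul_intCast, one_mul, hlb]
    dsimp only
    rw [Complex.exp_add, Complex.exp_add, Complex.exp_log (ha0 j), Complex.exp_log (hm j),
      Complex.exp_nat_mul, Complex.exp_log hmC, hratio]
    dsimp only
    have hden : (m : ℂ) ^ (A j).totalDegree * a j ≠ 0 := mul_ne_zero (pow_ne_zero _ hmC) (ha0 j)
    rw [mul_div_assoc', mul_comm ((m : ℂ) ^ (A j).totalDegree * a j), mul_div_assoc,
      div_self hden, mul_one]
  -- (C2) `‖cen(m) - m v‖ = O(log m)`
  have hlog1 : ∀ j, ∀ᶠ m : ℕ in atTop, ‖log (ratio j m)‖ ≤ 1 := by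
    intro j
    have h := (hlogratio j)
    rw [tendsto_zero_iff_norm_tendsto_zero] at h
    filter_upwards [h.eventually (gt_mem_nhds zero_lt_one)] with m hm
    exact hm.le
  have hcsmall : ∀ δ : ℝ, 0 < δ → ∀ᶠ m : ℕ in atTop,
      ‖cen m - fun i => (m : ℂ) * (2 * Real.pi * I * (q i : ℂ))‖ + 1 ≤ δ * m := by
    intro δ hδ
    set K : ℝ := ∑ j, (‖(2 * Real.pi * I * (p j : ℂ) : ℂ)‖ + ‖log (a j)‖) + 2 with hK
    set Dg : ℝ := ∑ j, ((A j).totalDegree : ℝ) with hDg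
    filter_upwards [eventually_all.2 hlog1, eventually_mul_log_add_le Dg K hδ, eventually_ge_atTop 1]
      with m hm hmδ hm1
    have hlogm : 0 ≤ Real.log m := Real.log_nonneg (by exact_mod_cast hm1)
    have hnlog : ‖log (m : ℂ)‖ = Real.log m := by
      rw [← Complex.natCast_log, Complex.norm_real, Real.norm_eq_abs, abs_of_nonneg hlogm]
    have hcomp : ∀ j, ‖(cen m - fun i => (m : ℂ) * (2 * Real.pi * I * (q i : ℂ))) j‖ ≤
        Dg * Real.log m + (K - 1) := by
      intro j
      have e : (cen m - fun i => (m : ℂ) * (2 * Real.pi * I * (q i : ℂ))) j =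
          2 * Real.pi * I * (p j : ℂ) + lb m j := by
        rw [Pi.sub_apply, hc']; ring
      rw [e, hlb]
      dsimp only
      have hdj : ((A j).totalDegree : ℝ) ≤ Dg :=
        Finset.single_le_sum (f := fun j => ((A j).totalDegree : ℝ)) (fun _ _ => by positivity)
          (Finset.mem_univ j)
      have hKj : ‖(2 * Real.pi * I * (p j : ℂ) : ℂ)‖ + ‖log (a j)‖ ≤ K - 2 := by
        have := Finset.single_le_sum
          (f := fun j => ‖(2 * Real.pi * I * (p j : ℂ) : ℂ)‖ + ‖log (a j)‖)
          (fun _ _ => by positivity) (Finset.mem_univ j)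
        rw [hK]; linarith
      have hn1 : ‖(((A j).totalDegree : ℕ) : ℂ) * log (m : ℂ)‖ = (A j).totalDegree * Real.log m := by
        rw [norm_mul, Complex.norm_natCast, hnlog]
      calc ‖2 * Real.pi * I * (p j : ℂ) +
            ((((A j).totalDegree : ℕ) : ℂ) * log (m : ℂ) + log (a j) + log (ratio j m))‖
          ≤ ‖(2 * Real.pi * I * (p j : ℂ) : ℂ)‖ +
            ‖(((A j).totalDegree : ℕ) : ℂ) * log (m : ℂ) + log (a j) + log (ratio j m)‖ :=
            norm_add_le _ _
        _ ≤ ‖(2 * Real.pi * I * (p j : ℂ) : ℂ)‖ +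
            (‖(((A j).totalDegree : ℕ) : ℂ) * log (m : ℂ)‖ + ‖log (a j)‖ + ‖log (ratio j m)‖) := by
            have h3 := norm_add₃_le (a := (((A j).totalDegree : ℕ) : ℂ) * log (m : ℂ))
              (b := log (a j)) (c := log (ratio j m))
            linarith
        _ ≤ Dg * Real.log m + (K - 1) := by
            rw [hn1]
            nlinarith [hm j, hdj, hKj, hlogm]
    have hD0 : 0 ≤ Dg := by rw [hDg]; exact Finset.sum_nonneg fun j _ => Nat.cast_nonneg _
    have hK2 : 2 ≤ K := by
      rw [hK]
      have := Finset.sum_nonneg fun j (_ : j ∈ (Finset.univ : Finset (Fin s))) =>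
        (show 0 ≤ ‖(2 * Real.pi * I * (p j : ℂ) : ℂ)‖ + ‖log (a j)‖ by positivity)
      linarith
    have hnn : 0 ≤ Dg * Real.log m + (K - 1) := by
      have := mul_nonneg hD0 hlogm
      linarith
    have hnorm : ‖cen m - fun i => (m : ℂ) * (2 * Real.pi * I * (q i : ℂ))‖ ≤
        Dg * Real.log m + (K - 1) :=
      (pi_norm_le_iff_of_nonneg hnn).2 hcomp
    linarith
  -- the linear functional and the perturbation
  obtain ⟨ℓ, hℓ⟩ : ∃ ℓ : (Fin s → ℂ) → ℂ, ℓ = fun x => ∑ i, (r i : ℂ) * x i + c := ⟨_, rfl⟩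
  obtain ⟨P, hP⟩ : ∃ P : ℕ → Fin s → (Fin s → ℂ) → ℂ,
    P = fun _ j x => exp (ℓ x) * (F j).eval (exp (ℓ x)) := ⟨_, rfl⟩
  have hℓdiff : Differentiable ℂ ℓ := by
    rw [hℓ]
    refine (Differentiable.fun_sum fun i _ => ?_).add_const _
    exact (differentiable_apply i).const_mul _
  have hPdiff : ∀ᶠ m : ℕ in atTop, ∀ j, DifferentiableOn ℂ (P m j) (ball (cen m) 1) := by
    filter_upwards with m j
    rw [hP]
    exact (hℓdiff.cexp.mul ((F j).differentiable.comp hℓdiff.cexp)).differentiableOn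
  -- (C3) the key estimate: `Re ℓ ≤ λ log m + C₀` on the unit polydisc around `cen m`
  set lam : ℝ := ∑ j, r j * (A j).totalDegree with hlamdef
  set C₀ : ℝ := ‖c‖ + ∑ j, |r j| * (‖log (a j)‖ + 2) with hC₀
  have hkey : ∀ᶠ m : ℕ in atTop, ∀ ξ : Fin s → ℂ, ‖ξ‖ ≤ 1 →
      (ℓ (cen m + ξ)).re ≤ lam * Real.log m + C₀ := by
    filter_upwards [eventually_all.2 hlog1] with m hm ξ hξ
    have hterm : ∀ j, ((r j : ℂ) * (cen m j + ξ j)).re ≤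
        r j * (A j).totalDegree * Real.log m + |r j| * (‖log (a j)‖ + 2) := by
      intro j
      rw [Complex.re_ofReal_mul, hc', hlb]
      dsimp only
      have hre : ((m : ℂ) * (2 * Real.pi * I * (q j : ℂ)) + (2 * Real.pi * I * (p j : ℂ) +
          ((((A j).totalDegree : ℕ) : ℂ) * log (m : ℂ) + log (a j) + log (ratio j m))) + ξ j).re =
          (A j).totalDegree * Real.log m + ((log (a j)).re + (log (ratio j m)).re + (ξ j).re) := by
        rw [← Complex.natCast_log]
        simp only [Complex.add_re, Complex.mul_re, Complex.mul_im, Complex.natCast_re,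
          Complex.natCast_im, Complex.ofReal_re, Complex.ofReal_im, Complex.I_re, Complex.I_im,
          Complex.re_ofNat, Complex.im_ofNat, Complex.intCast_re, Complex.intCast_im, mul_zero,
          zero_mul, add_zero, zero_add, sub_zero, mul_one, sub_self]
        ring
      rw [hre, mul_add]
      have ht : |(log (a j)).re + (log (ratio j m)).re + (ξ j).re| ≤ ‖log (a j)‖ + 2 := by
        have h1 := Complex.abs_re_le_norm (log (a j))
        have h2 := (Complex.abs_re_le_norm (log (ratio j m))).trans (hm j)
        have h3 := (Complex.abs_re_le_norm (ξ j)).trans ((norm_le_pi_norm ξ j).trans hξ)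
        have := abs_add_three ((log (a j)).re) ((log (ratio j m)).re) ((ξ j).re)
        linarith
      have h4 : r j * ((log (a j)).re + (log (ratio j m)).re + (ξ j).re) ≤ |r j| * (‖log (a j)‖ + 2) := by
        calc r j * ((log (a j)).re + (log (ratio j m)).re + (ξ j).re)
            ≤ |r j * ((log (a j)).re + (log (ratio j m)).re + (ξ j).re)| := le_abs_self _
          _ = |r j| * |(log (a j)).re + (log (ratio j m)).re + (ξ j).re| := abs_mul _ _
          _ ≤ |r j| * (‖log (a j)‖ + 2) := mul_le_mul_of_nonneg_left ht (abs_nonneg _)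
      nlinarith [h4]
    have hℓre : (ℓ (cen m + ξ)).re = ∑ i, ((r i : ℂ) * (cen m i + ξ i)).re + c.re := by
      rw [hℓ]; simp only [Complex.add_re, Complex.re_sum, Pi.add_apply]
    rw [hℓre]
    have hsum := Finset.sum_le_sum fun j (_ : j ∈ Finset.univ) => hterm j
    rw [Finset.sum_add_distrib, ← Finset.sum_mul] at hsum
    have hc'' : c.re ≤ ‖c‖ := Complex.re_le_norm c
    rw [hC₀, hlamdef]
    linarith
  -- (C4) relative smallness of the perturbation: `‖P_j‖ ≤ K_j m^{μ_j}`, `μ_j < d_j`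
  set B : Fin s → ℝ := fun j => ∑ i ∈ Finset.range ((F j).natDegree + 1), ‖(F j).coeff i‖ with hB
  have hB0 : ∀ j, 0 ≤ B j := fun j => Finset.sum_nonneg fun i _ => norm_nonneg _
  set μ : Fin s → ℝ := fun j => lam + max lam 0 * ((F j).natDegree : ℝ) with hμ
  have hμlt : ∀ j, μ j < (A j).totalDegree := fun j => hlam j
  set Kc : Fin s → ℝ := fun j => Real.exp C₀ * (B j * Real.exp |C₀| ^ (F j).natDegree) with hKc
  have hPbound : ∀ᶠ m : ℕ in atTop, ∀ j, ∀ ξ : Fin s → ℂ, ‖ξ‖ ≤ 1 →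
      ‖P m j (cen m + ξ)‖ ≤ Kc j * (m : ℝ) ^ μ j := by
    filter_upwards [hkey, eventually_ge_atTop 1] with m hm hm_one j ξ hξ
    have hm1' : (1 : ℝ) ≤ m := by exact_mod_cast hm_one
    have hm0 : (0 : ℝ) < m := by linarith
    have hre := hm ξ hξ
    have hexp : ‖exp (ℓ (cen m + ξ))‖ ≤ Real.exp C₀ * (m : ℝ) ^ lam := by
      rw [Complex.norm_exp]
      refine (Real.exp_le_exp.mpr hre).trans ?_
      rw [show lam * Real.log m + C₀ = C₀ + lam * Real.log m by ring, Real.exp_add,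
        Real.rpow_def_of_pos hm0, mul_comm (Real.log m)]
    have hmax : max 1 ‖exp (ℓ (cen m + ξ))‖ ≤ Real.exp |C₀| * (m : ℝ) ^ max lam 0 := by
      have h1 : (1 : ℝ) ≤ Real.exp |C₀| * (m : ℝ) ^ max lam 0 := by
        have ha' : (1 : ℝ) ≤ Real.exp |C₀| := Real.one_le_exp (abs_nonneg _)
        have hb : (1 : ℝ) ≤ (m : ℝ) ^ max lam 0 := Real.one_le_rpow hm1' (le_max_right _ _)
        nlinarith
      have h2 : Real.exp C₀ * (m : ℝ) ^ lam ≤ Real.exp |C₀| * (m : ℝ) ^ max lam 0 :=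
        mul_le_mul (Real.exp_le_exp.2 (le_abs_self _))
          (Real.rpow_le_rpow_of_exponent_le hm1' (le_max_left _ _))
          (Real.rpow_nonneg hm0.le _) (Real.exp_pos _).le
      exact max_le h1 (hexp.trans h2)
    have hF : ‖(F j).eval (exp (ℓ (cen m + ξ)))‖ ≤
        B j * (Real.exp |C₀| * (m : ℝ) ^ max lam 0) ^ (F j).natDegree :=
      (norm_eval_le_sum_mul_pow (F j) _).trans
        (mul_le_mul_of_nonneg_left (pow_le_pow_left₀ (zero_le_one.trans (le_max_left _ _)) hmax _)
          (hB0 j))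
    rw [hP]
    dsimp only
    calc ‖exp (ℓ (cen m + ξ)) * (F j).eval (exp (ℓ (cen m + ξ)))‖
        = ‖exp (ℓ (cen m + ξ))‖ * ‖(F j).eval (exp (ℓ (cen m + ξ)))‖ := norm_mul _ _
      _ ≤ (Real.exp C₀ * (m : ℝ) ^ lam) *
          (B j * (Real.exp |C₀| * (m : ℝ) ^ max lam 0) ^ (F j).natDegree) :=
          mul_le_mul hexp hF (norm_nonneg _) (by positivity)
      _ = Kc j * ((m : ℝ) ^ lam * ((m : ℝ) ^ max lam 0) ^ (F j).natDegree) := by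
          rw [hKc, mul_pow]; ring
      _ = Kc j * (m : ℝ) ^ μ j := by
          rw [hμ, ← Real.rpow_natCast, ← Real.rpow_mul hm0.le, Real.rpow_add hm0]
  have hPsmall : ∀ j, ∀ θ : ℝ, 0 < θ → ∀ᶠ m : ℕ in atTop, ∀ ξ : Fin s → ℂ, ‖ξ‖ < 1 →
      ‖P m j (cen m + ξ)‖ ≤ θ * (m : ℝ) ^ (A j).totalDegree := by
    intro j θ hθ
    have hK0 : 0 ≤ Kc j := by positivity
    have hev : ∀ᶠ m : ℕ in atTop, Kc j * (m : ℝ) ^ μ j ≤ θ * (m : ℝ) ^ ((A j).totalDegree : ℝ) := by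
      have hgap : 0 < ((A j).totalDegree : ℝ) - μ j := by linarith [hμlt j]
      have h1 : Tendsto (fun m : ℕ => (m : ℝ) ^ (((A j).totalDegree : ℝ) - μ j)) atTop atTop :=
        (tendsto_rpow_atTop hgap).comp tendsto_natCast_atTop_atTop
      filter_upwards [h1.eventually_ge_atTop (Kc j / θ), eventually_ge_atTop 1] with m hm hm_one
      have hm0 : (0 : ℝ) < m := by exact_mod_cast hm_one
      have h2 : Kc j ≤ θ * (m : ℝ) ^ (((A j).totalDegree : ℝ) - μ j) := by
        rw [div_le_iff₀ hθ] at hm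
        linarith [hm]
      calc Kc j * (m : ℝ) ^ μ j ≤ θ * (m : ℝ) ^ (((A j).totalDegree : ℝ) - μ j) * (m : ℝ) ^ μ j :=
            mul_le_mul_of_nonneg_right h2 (Real.rpow_nonneg hm0.le _)
        _ = θ * (m : ℝ) ^ ((A j).totalDegree : ℝ) := by
            rw [mul_assoc, ← Real.rpow_add hm0, sub_add_cancel]
    filter_upwards [hPbound, hev] with m hm hmθ ξ hξ
    have h := hm j ξ hξ.le
    rw [← Real.rpow_natCast]
    exact h.trans hmθ
  -- (C5) solutions near the centres, and a sequence with `x(m) - cen(m) → 0`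
  have hsol : ∀ ε : ℝ, 0 < ε → ∀ᶠ m : ℕ in atTop, ∃ x ∈ {x : Fin s → ℂ |
      ∀ j, exp (x j) = eval x (A j) + P m j x}, ‖x - cen m‖ ≤ ε := by
    intro ε hε
    filter_upwards [exists_exp_eq_poly_add_near_centre q A hA cen hcexp hcsmall P hPdiff hPsmall hε]
      with m hm
    obtain ⟨x, hx, hsol⟩ := hm
    exact ⟨x, hsol, hx⟩
  obtain ⟨x, hxS, hxc⟩ := exists_seq_of_forall_eventually_exists_near _ cen hsol
  refine ⟨x, fun m => x m - (((Real.log m : ℝ) : ℂ) • (fun j => (((A j).totalDegree : ℕ) : ℂ)) +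
    (2 * Real.pi * I * (m : ℂ)) • (fun j => (q j : ℂ))), ?_, fun m => ?_, ?_⟩
  · filter_upwards [hxS] with m hm j
    have h := hm j
    rw [hP, hℓ] at h
    exact h
  · rw [add_assoc, sub_add_cancel]
  · -- `ρ(m) = (x(m) - cen(m)) + rp(m) → 0 + r_p`
    have he : (fun m : ℕ => x m - (((Real.log m : ℝ) : ℂ) • (fun j => (((A j).totalDegree : ℕ) : ℂ)) +
        (2 * Real.pi * I * (m : ℂ)) • (fun j => (q j : ℂ)))) = fun m => (x m - cen m) + rp m := by
      funext m
      rw [hcen, hrc, hd, hy, Complex.natCast_log]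
      dsimp only
      abel
    rw [he]
    simp only [ha] at hrp_lim
    have h := hxc.add hrp_lim
    rw [zero_add] at h
    exact h

end SlowLabelled

end Summit.Schanuel.Schanuel.Theorems

end
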